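import Literature.NumberTheory.Transcendental.KZCubicalCalculus
import Literature.NumberTheory.Transcendental.KZDominatedFamilyRelations
import Literature.NumberTheory.Transcendental.BoxCoordinatePowerMap

/-!
# `ReductionRigidity` (stmt-KontsevichZagierPeriods-3407), line `Sketch`, stub `stub_zetaTwoCorner`:
# the ζ(2) corner is move-equivalent to the alternating box

Route `KontsevichZagierPeriods/HermiteRigidity`, crux `ReductionRigidity` (stmt-3407), growth line
`bloch-suslin-rational-dilog`, census item N7/G8 `ZetaTwoOnAlternatingIsland`. Kontsevich–Zagier's own
example `ζ(2) = ∫∫_□ dx dy/(1 − xy)` has a SINGULAR CORNER `(1,1)` and therefore lies on none of the landed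
box islands (all of level `ν > 1` or `ν < 0`). This file moves it onto the alternating island:

  `[□², 1/(1 − xy)] − [□², 2/(1 + xy)] ∈ KZ.relations`        (`stub_zetaTwoCorner`)

(both values are `ζ(2)`: this is the duplication formula `Li₂(z²) = 2Li₂(z) + 2Li₂(−z)` at the corner
`z = 1`, i.e. `Li₂(1) = −2Li₂(−1)`). Here `r` is ANY representation on the closed square whose
integrand agrees with `1/(1 − xy)` off the corner and `s` is any representation of `2/(1 + xy)` on the
closed square. Moves (rules (1a), (1b), (2) of [Kontsevich–Zagier 2001, §1.2] only):

1. restrict `r` and `s` to the open square `O = (0,1)²`, the boundary of the square being null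
   (domain additivity, `KZ.IntegralRep.of_sub_of_restrict_mem_relations`);
2. ONE change of variables along the squaring chart `Φ(p,q) = (p², q²)` of `O` onto itself
   (`BoxIntegral.coordPow 2`, Jacobian `|det Φ'| = 4pq`): `[O, 4pq/(1 − p²q²)] ≡ [O, 1/(1 − pq)]`, the
   left representation being CONSTRUCTED with integrability transported from `r` along `Φ`
   (`MeasureTheory.integrableOn_image_iff_integrableOn_abs_det_fderiv_smul`), never computed;
3. the partial fraction `4pq/(1 − p²q²) = 1/(1 − pq) + (1/(1 − pq) − 2/(1 + pq))` on `O` (two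
   integrand additivities through the difference representation `[O, r − s]`).

The squaring move of the sibling file `HermiteRigidityIslandComplementBoxDuplication.lean`
(`rel_coordPow_two`, levels `M ≥ 2`) runs on the CLOSED cube with regular integrands; at level `M = 1`
the corner forces the open square, which is why the chart is redone here on `(0,1)ⁿ`.

References: M. Kontsevich, D. Zagier, *Periods* (2001), §1.1 (the example `ζ(2)`), §1.2 rules (1), (2)
[cite: KontsevichZagier2001, §1.2]. No definitions are introduced.
-/

noncomputable section

open MeasureTheory Set MvPolynomial

namespace Summit.KontsevichZagierPeriods.HermiteRigidity.ReductionRigidity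

open Literature.NumberTheory.Transcendental
open Literature.NumberTheory.Transcendental.KZ
open Literature.ModelTheory.ExponentialFields (IsSemialgebraic)

/-! ## The open unit cube inside the closed one -/

/-- The open unit cube `(0,1)ⁿ` lies in the closed unit cube `[0,1]ⁿ`. [folklore] -/
theorem zetaTwoCorner_openUnitCube_subset_cube (n : ℕ) : openUnitCube n ⊆ cube n :=
  fun _ hx i => ⟨(hx i).1.le, (hx i).2.le⟩

/-- The boundary `[0,1]ⁿ ∖ (0,1)ⁿ` is Lebesgue-null: it lies in the finite union of the coordinate
hyperplanes `{xᵢ = 0}`, `{xᵢ = 1}` (`MeasureTheory.Measure.pi_hyperplane`). [folklore] -/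
theorem zetaTwoCorner_volume_cube_diff_openUnitCube (n : ℕ) :
    volume (cube n \ openUnitCube n) = 0 := by
  have hsub : cube n \ openUnitCube n ⊆
      ⋃ i : Fin n, ({x : Fin n → ℝ | x i = 0} ∪ {x | x i = 1}) := by
    rintro x ⟨hx, hx'⟩
    simp only [mem_openUnitCube_iff, mem_Ioo, not_forall] at hx'
    obtain ⟨i, hi⟩ := hx'
    refine mem_iUnion.2 ⟨i, ?_⟩
    have h0 := mem_cube.1 hx i
    rcases not_and_or.mp hi with h | h
    · exact Or.inl (le_antisymm (not_lt.mp h) h0.1)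
    · exact Or.inr (le_antisymm h0.2 (not_lt.mp h))
  refine measure_mono_null hsub (measure_iUnion_null fun i => ?_)
  rw [measure_union_null_iff, volume_pi]
  exact ⟨Measure.pi_hyperplane _ i 0, Measure.pi_hyperplane _ i 1⟩

/-- **Restriction to the open cube (rule (1a)).** A representation on the closed cube `[0,1]ⁿ` is
move-equivalent to its restriction to the open cube `(0,1)ⁿ` (same integrand), the boundary being
null (`KZ.IntegralRep.of_sub_of_restrict_mem_relations`). [cite: KontsevichZagier2001, §1.2 rule (1)] -/
theorem zetaTwoCorner_exists_restrict_openUnitCube {n : ℕ} (r : IntegralRep n)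
    (hr : r.domain = cube n) :
    ∃ r' : IntegralRep n, r'.domain = openUnitCube n ∧ r'.integrand = r.integrand ∧
      KZ.of r - KZ.of r' ∈ KZ.relations := by
  have hsub : openUnitCube n ⊆ r.domain := by
    rw [hr]
    exact zetaTwoCorner_openUnitCube_subset_cube n
  exact ⟨r.restrict (openUnitCube n) isSemialgebraic_openUnitCube hsub, rfl, rfl,
    r.of_sub_of_restrict_mem_relations isSemialgebraic_openUnitCube hsub
      (by rw [hr]; exact zetaTwoCorner_volume_cube_diff_openUnitCube n)⟩

/-! ## The coordinate power chart on the open cube -/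

/-- **Pull-back along the coordinate power chart (rule (2)).** For `m ≥ 1` and a representation `ρ`
on the open cube `(0,1)ⁿ`, the pulled-back function `x ↦ mⁿ ∏ᵢ xᵢ^(m-1) · ρ.integrand (xᵢᵐ)ᵢ` is
again a representation `ρ₁` on `(0,1)ⁿ` — `ℚ`-semialgebraic as the product of a polynomial with the
composite of `ρ.integrand` and the polynomial map `Φₘ = BoxIntegral.coordPow m` (Tarski–Seidenberg),
and integrable by TRANSPORT of `ρ.integrableOn` along `Φₘ`
(`BoxIntegral.integrableOn_box_iff_integrableOn_coordPow`, i.e. Mathlib's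
`integrableOn_image_iff_integrableOn_abs_det_fderiv_smul`) — and `[ρ₁] − [ρ]` is ONE
change-of-variables generator: `Φ = Φₘ` is injective on `(0,1)ⁿ` with image `(0,1)ⁿ`, derivative
`diag(m xᵢ^(m-1))` and `|det| = mⁿ ∏ᵢ xᵢ^(m-1)` there. [cite: KontsevichZagier2001, §1.2 rule (2)] -/
theorem zetaTwoCorner_exists_coordPow_pullback {n m : ℕ} (hm : m ≠ 0) (ρ : IntegralRep n)
    (hρ : ρ.domain = openUnitCube n) :
    ∃ ρ₁ : IntegralRep n, ρ₁.domain = openUnitCube n ∧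
      (ρ₁.integrand = fun x => ((m : ℝ) ^ n * ∏ i, x i ^ (m - 1)) *
        ρ.integrand (BoxIntegral.coordPow m x)) ∧
      KZ.of ρ₁ - KZ.of ρ ∈ KZ.changeOfVariablesRel := by
  have hO : IsSemialgebraic ℚ (openUnitCube n) := isSemialgebraic_openUnitCube
  -- semialgebraicity of the pulled-back integrand
  have hmaps : MapsTo (BoxIntegral.coordPow (n := n) m) (openUnitCube n) ρ.domain := by
    rw [hρ]
    exact BoxIntegral.mapsTo_coordPow_box hm
  have hΦ : IsSemialgebraicMapOn ℚ (openUnitCube n) (BoxIntegral.coordPow (n := n) m) :=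
    (isSemialgebraicMapOn_aeval hO fun j => (X j : MvPolynomial (Fin n) ℚ) ^ m).congr
      fun x _ => by ext j; simp
  have hcomp : IsSemialgebraicFunOn ℚ (openUnitCube n) (ρ.integrand ∘ BoxIntegral.coordPow m) :=
    IsSemialgebraicFunOn.comp_isSemialgebraicMapOn_holds ρ.isSemialgebraicFunOn_integrand hΦ hmaps
  have hjac : IsSemialgebraicFunOn ℚ (openUnitCube n)
      (fun x => (m : ℝ) ^ n * ∏ i, x i ^ (m - 1)) :=
    (isSemialgebraicFunOn_aeval hO
      (C ((m : ℚ) ^ n) * ∏ i, (X i : MvPolynomial (Fin n) ℚ) ^ (m - 1))).congr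
      fun x _ => by simp [map_prod]
  have hsa : IsSemialgebraicFunOn ℚ (openUnitCube n)
      (fun x => ((m : ℝ) ^ n * ∏ i, x i ^ (m - 1)) * ρ.integrand (BoxIntegral.coordPow m x)) :=
    IsSemialgebraicFunOn.mul_holds hjac hcomp
  -- integrability: transported from `ρ` along the chart, never computed
  have hρint : IntegrableOn ρ.integrand (openUnitCube n) := hρ ▸ ρ.integrableOn
  have hint : IntegrableOn
      (fun x => ((m : ℝ) ^ n * ∏ i, x i ^ (m - 1)) * ρ.integrand (BoxIntegral.coordPow m x))
      (openUnitCube n) :=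
    (BoxIntegral.integrableOn_box_iff_integrableOn_coordPow hm ρ.integrand).1 hρint
  refine ⟨⟨openUnitCube n, _, hO, hsa, hint⟩, rfl, rfl, ?_⟩
  refine ⟨n, _, ρ, BoxIntegral.coordPow m, BoxIntegral.coordPowDeriv m, hΦ,
    fun x _ => BoxIntegral.hasFDerivWithinAt_coordPow m _ x, BoxIntegral.injOn_coordPow_box hm,
    ?_, fun x hx => ?_, rfl⟩
  · rw [hρ]
    exact (BoxIntegral.image_coordPow_box hm).symm
  · show ((m : ℝ) ^ n * ∏ i, x i ^ (m - 1)) * ρ.integrand (BoxIntegral.coordPow m x) =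
      ρ.integrand (BoxIntegral.coordPow m x) * |(BoxIntegral.coordPowDeriv m x).det|
    rw [BoxIntegral.abs_det_coordPowDeriv hm hx, mul_comm]

/-! ## The difference representation -/

/-- The difference of two representations on a common domain is a representation on it
(`ℚ`-semialgebraic by Tarski–Seidenberg, integrable as a difference). [folklore] -/
theorem zetaTwoCorner_exists_subRep {n : ℕ} (a b : IntegralRep n) (h : b.domain = a.domain) :
    ∃ u : IntegralRep n, u.domain = a.domain ∧ u.integrand = a.integrand - b.integrand :=
  ⟨⟨a.domain, a.integrand - b.integrand, a.isSemialgebraic_domain,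
    IsSemialgebraicFunOn.sub_holds a.isSemialgebraicFunOn_integrand
      (h ▸ b.isSemialgebraicFunOn_integrand),
    a.integrableOn.sub (h ▸ b.integrableOn)⟩, rfl, rfl⟩

/-! ## The registered stub -/

/-- **Stub `stub_zetaTwoCorner`** (crux `ReductionRigidity`, stmt-3407, line `Sketch`, census item
`ZetaTwoOnAlternatingIsland`): **the ζ(2) corner is move-equivalent to the alternating box**,
`[□², 1/(1 − xy)] − [□², 2/(1 + xy)] ∈ KZ.relations`, for ANY representation `r` on the closed square
whose integrand is `1/(1 − xy)` off the corner `xy = 1` and any representation `s` of `2/(1 + xy)` on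
the closed square. Chain of moves: restrict both to the open square (null boundary, rule (1a)); one
change of variables along the squaring chart `(p,q) ↦ (p², q²)` of the open square, Jacobian `4pq`
(rule (2)), giving `[O, 1/(1 − pq)] ≡ [O, 4pq/(1 − p²q²)]` with integrability transported from `r`;
and the partial fraction `4pq/(1 − p²q²) = 1/(1 − pq) + (1/(1 − pq) − 2/(1 + pq))` (rule (1b), twice).
[cite: KontsevichZagier2001, §1.2 rules (1), (2)] -/
theorem stub_zetaTwoCorner : ∀ (r s : IntegralRep 2), r.domain = cube 2 →
    EqOn r.integrand (fun p => 1 / (1 - p 0 * p 1)) (cube 2 ∩ {p | p 0 * p 1 < 1}) →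
    s.domain = cube 2 → EqOn s.integrand (fun p => 2 / (1 + p 0 * p 1)) (cube 2) →
    KZ.of r - KZ.of s ∈ KZ.relations := by
  intro r s hr hri hs hsi
  -- (1a) restriction to the open square `O = (0,1)²`
  obtain ⟨rO, hrOd, hrOi, hA⟩ := zetaTwoCorner_exists_restrict_openUnitCube r hr
  obtain ⟨sO, hsOd, hsOi, hB⟩ := zetaTwoCorner_exists_restrict_openUnitCube s hs
  -- (2) the squaring chart: `[r₁] = [O, 4pq · r(p², q²)] ≡ [rO]`
  obtain ⟨r₁, hr₁d, hr₁i, hC⟩ :=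
    zetaTwoCorner_exists_coordPow_pullback (m := 2) two_ne_zero rO hrOd
  -- the difference representation `u = [O, r − s]`
  obtain ⟨u, hud, hui⟩ := zetaTwoCorner_exists_subRep rO sO (by rw [hsOd, hrOd])
  -- pointwise values on the open square
  have hval : ∀ x ∈ openUnitCube 2,
      r.integrand x = 1 / (1 - x 0 * x 1) ∧
      r.integrand (BoxIntegral.coordPow 2 x) = 1 / (1 - x 0 ^ 2 * x 1 ^ 2) ∧
      s.integrand x = 2 / (1 + x 0 * x 1) := by
    intro x hx
    have hxc : x ∈ cube 2 := zetaTwoCorner_openUnitCube_subset_cube 2 hx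
    have hx2 : BoxIntegral.coordPow 2 x ∈ openUnitCube 2 := BoxIntegral.mapsTo_coordPow_box two_ne_zero hx
    refine ⟨hri ⟨hxc, ?_⟩, ?_, hsi hxc⟩
    · exact mul_lt_one_of_nonneg_of_lt_one_left (hx 0).1.le (hx 0).2 (hx 1).2.le
    · have h := hri ⟨zetaTwoCorner_openUnitCube_subset_cube 2 hx2,
        mul_lt_one_of_nonneg_of_lt_one_left (hx2 0).1.le (hx2 0).2 (hx2 1).2.le⟩
      simpa using h
  -- (1b) `[r₁] ≡ [rO] + [u]`: the partial fraction `4pq/(1 − p²q²) = 1/(1 − pq) + (1/(1 − pq) − 2/(1 + pq))`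
  have hD : KZ.of r₁ - KZ.of rO - KZ.of u ∈ KZ.relations := by
    refine integrandAddRel_subset_relations ⟨2, r₁, rO, u, by rw [hrOd, hr₁d],
      by rw [hud, hrOd, hr₁d], fun x hx => ?_, rfl⟩
    rw [hr₁d] at hx
    obtain ⟨h₁, h₂, h₃⟩ := hval x hx
    have hx0 := hx 0
    have hx1 := hx 1
    simp only [mem_Ioo] at hx0 hx1
    have hlt : x 0 * x 1 < 1 := mul_lt_one_of_nonneg_of_lt_one_left hx0.1.le hx0.2 hx1.2.le
    have h0 : 0 < x 0 * x 1 := mul_pos hx0.1 hx1.1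
    have hlt2 : (x 0 * x 1) * (x 0 * x 1) < 1 := by nlinarith
    have hne₁ : (1 : ℝ) - x 0 * x 1 ≠ 0 := by nlinarith
    have hne₂ : (1 : ℝ) + x 0 * x 1 ≠ 0 := by nlinarith
    have hne₃ : (1 : ℝ) - x 0 ^ 2 * x 1 ^ 2 ≠ 0 := by nlinarith
    rw [hr₁i, Pi.add_apply, hui, Pi.sub_apply, hrOi, hsOi]
    beta_reduce
    rw [h₁, h₂, h₃]
    simp only [Fin.prod_univ_two, Nat.cast_ofNat, Nat.add_one_sub_one, pow_one]
    field_simp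
    ring
  -- (1b) `[rO] ≡ [u] + [sO]`
  have hE : KZ.of rO - KZ.of u - KZ.of sO ∈ KZ.relations :=
    integrandAddRel_subset_relations ⟨2, rO, u, sO, hud, by rw [hsOd, hrOd],
      fun x _ => by simp [hui], rfl⟩
  -- bookkeeping
  have key : KZ.of r - KZ.of s = (KZ.of r - KZ.of rO) - (KZ.of s - KZ.of sO) +
      (KZ.of rO - KZ.of u - KZ.of sO) + (KZ.of r₁ - KZ.of rO) - (KZ.of r₁ - KZ.of rO - KZ.of u) := by
    abel
  rw [key]
  exact KZ.relations.sub_mem (KZ.relations.add_mem (KZ.relations.add_mem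
    (KZ.relations.sub_mem hA hB) hE) (changeOfVariablesRel_subset_relations hC)) hD

end Summit.KontsevichZagierPeriods.HermiteRigidity.ReductionRigidity

end
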